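import Summits.CriticalPhenomena.PercolationContinuityZ3.Theorems.Transplant.StatementPolynomialGrowth
import Summits.CriticalPhenomena.PercolationContinuityZ3.Theorems.TransplantHeisenberg
import Literature.Probability.Percolation.GrimmettMarstrand
import Mathlib.Tactic.FinCases
import HarnessLib

/-!
# The two Heisenberg Cayley graphs of the tree are isomorphic; the two `θ(p_c) = 0` targets are equivalent

builds on p205010 (kernel theorem, internal audit signed; external expert review pending).
Status sentence (coordinator 2026-08-20T04:30Z): "θ(p_c) = 0 on ℤ^d, all d ≥ 2 — kernel-verified (Lean 4/Mathlib,
standard axioms); internal adversarial audit SIGNED 2026-08-20 04:29Z; external expert review pending."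

PROOF-ONLY reconciliation (no definitions of mathematical content; one `Equiv` and one graph isomorphism as data), lane `prim-bschramm-*`,
seat `prim-bschramm-stmt`.  On 2026-08-20 two statements of "critical bond percolation dies on the Cayley graph of `H₃(ℤ)` w.r.t. `a, b`"
landed within minutes of each other:
* `Transplant.HeisenbergCriticalContinuity` (`StatementPolynomialGrowth.lean`, this seat) on the tree's OLDER carrier
  `Literature.Geometry.MetricEmbeddings.cayleyGraph : SimpleGraph (ℤ × ℤ × ℤ)` (`HeisenbergL1.lean:123`, Cheeger–Kleiner–Naor vocabulary), and
* `Heisenberg.HeisenbergCriticalContinuity` (`TransplantHeisenberg.lean`, seat `prim-bschramm-p3`) on `Heisenberg.heisenbergGraph :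
  SimpleGraph (Fin 3 → ℤ)` with the same group law `(a,b,c)·(a',b',c') = (a+a', b+b', c+c'+ab')` and the same right generators.
This file proves they are the SAME target: `heisenbergCarrierIso : Heisenberg.heisenbergGraph ≃g cayleyGraph` (coordinates
`x ↦ (x 0, x 1, x 2)`, identity on the group law), hence `θ` and `p_c` agree at the identity (`theta_iso`, `criticalProb_iso`,
`Literature/Probability/Percolation/GrimmettMarstrand.lean:110-127`) and
`heisenbergCriticalContinuity_iff : Transplant.HeisenbergCriticalContinuity ↔ Heisenberg.HeisenbergCriticalContinuity`.
Either may be closed; the other follows by this file.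
-/

noncomputable section

namespace Summit.CriticalPhenomena.PercolationContinuityZ3.Theorems.Transplant

open MeasureTheory Literature.Probability.Percolation Literature.Probability.LatticeModels
open Literature.Geometry.MetricEmbeddings (cayleyGraph)
open Summit.CriticalPhenomena.PercolationContinuityZ3.Theorems.Heisenberg (HV heisenbergGraph)

/-- The coordinate identification `(Fin 3 → ℤ) ≃ ℤ × ℤ × ℤ`, `x ↦ (x 0, x 1, x 2)`. [folklore] -/
def carrierEquiv : HV ≃ (ℤ × ℤ × ℤ) where
  toFun x := (x 0, x 1, x 2)
  invFun p := ![p.1, p.2.1, p.2.2]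
  left_inv x := by funext i; fin_cases i <;> rfl
  right_inv _ := rfl

/-- `carrierEquiv` in coordinates. [folklore] -/
@[simp] theorem carrierEquiv_apply (x : HV) : carrierEquiv x = (x 0, x 1, x 2) := rfl

/-- Right multiplication by `a` in p3's coordinates, read through `carrierEquiv`. [folklore] -/
theorem carrierEquiv_mul_genA (x : HV) :
    carrierEquiv (Heisenberg.heisMul x Heisenberg.genA) = (x 0 + 1, x 1, x 2) := by
  simp [Heisenberg.heisMul, Heisenberg.genA]

/-- Right multiplication by `b` in p3's coordinates, read through `carrierEquiv`. [folklore] -/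
theorem carrierEquiv_mul_genB (x : HV) :
    carrierEquiv (Heisenberg.heisMul x Heisenberg.genB) = (x 0, x 1 + 1, x 2 + x 0) := by
  simp [Heisenberg.heisMul, Heisenberg.genB]

/-- The generating relations correspond under `carrierEquiv`. [folklore] -/
theorem carrier_rel_iff (x y : HV) :
    (carrierEquiv y = ((carrierEquiv x).1 + 1, (carrierEquiv x).2.1, (carrierEquiv x).2.2) ∨
        carrierEquiv y = ((carrierEquiv x).1, (carrierEquiv x).2.1 + 1, (carrierEquiv x).2.2 + (carrierEquiv x).1)) ↔
      (y = Heisenberg.heisMul x Heisenberg.genA ∨ y = Heisenberg.heisMul x Heisenberg.genB) := by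
  rw [← carrierEquiv.injective.eq_iff (a := y) (b := Heisenberg.heisMul x Heisenberg.genA),
    ← carrierEquiv.injective.eq_iff (a := y) (b := Heisenberg.heisMul x Heisenberg.genB),
    carrierEquiv_mul_genA, carrierEquiv_mul_genB]
  simp only [carrierEquiv_apply]

/-- **The two Heisenberg Cayley graphs of the tree are isomorphic** (same group law, same right generators `a = (1,0,0)`, `b = (0,1,0)`;
only the carrier differs: `Fin 3 → ℤ` vs `ℤ × ℤ × ℤ`). [folklore] -/
def heisenbergCarrierIso : heisenbergGraph ≃g cayleyGraph where
  toEquiv := carrierEquiv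
  map_rel_iff' := by
    intro x y
    simp only [heisenbergGraph, cayleyGraph, SimpleGraph.fromRel_adj, ne_eq, carrierEquiv.injective.eq_iff, carrier_rel_iff]

/-- The isomorphism fixes the identity element. [folklore] -/
theorem heisenbergCarrierIso_zero : heisenbergCarrierIso (0 : HV) = ((0, 0, 0) : ℤ × ℤ × ℤ) := rfl

/-- `θ` at the identity agrees on the two carriers (tree `theta_iso`). [folklore] -/
theorem theta_cayleyGraph_eq_theta_heisenbergGraph (p : unitInterval) :
    theta cayleyGraph ((0, 0, 0) : ℤ × ℤ × ℤ) p = theta heisenbergGraph (0 : HV) p := by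
  rw [← heisenbergCarrierIso_zero]
  exact theta_iso heisenbergCarrierIso 0 p

/-- The own critical points at the identity agree on the two carriers (tree `criticalProb_iso`). [folklore] -/
theorem criticalProbIOf_cayleyGraph_eq :
    criticalProbIOf cayleyGraph ((0, 0, 0) : ℤ × ℤ × ℤ) = criticalProbIOf heisenbergGraph (0 : HV) := by
  apply Subtype.ext
  change criticalProb cayleyGraph ((0, 0, 0) : ℤ × ℤ × ℤ) = criticalProb heisenbergGraph (0 : HV)
  rw [← heisenbergCarrierIso_zero]
  exact criticalProb_iso heisenbergCarrierIso 0

/-- **The two Heisenberg targets of the lane are equivalent**: `Transplant.HeisenbergCriticalContinuity` (carrier `ℤ × ℤ × ℤ`) ↔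
`Heisenberg.HeisenbergCriticalContinuity` (carrier `Fin 3 → ℤ`, seat p3).  Close either one. [folklore] -/
theorem heisenbergCriticalContinuity_iff :
    HeisenbergCriticalContinuity ↔ Heisenberg.HeisenbergCriticalContinuity := by
  unfold HeisenbergCriticalContinuity Heisenberg.HeisenbergCriticalContinuity
  rw [criticalProbIOf_cayleyGraph_eq, theta_cayleyGraph_eq_theta_heisenbergGraph]

/-- Transfer p3 ⟹ this seat's statement. [folklore] -/
theorem heisenbergCriticalContinuity_of_p3 (h : Heisenberg.HeisenbergCriticalContinuity) : HeisenbergCriticalContinuity :=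
  heisenbergCriticalContinuity_iff.2 h

/-- Transfer this seat's statement ⟹ p3's. [folklore] -/
theorem heisenbergCriticalContinuity_to_p3 (h : HeisenbergCriticalContinuity) : Heisenberg.HeisenbergCriticalContinuity :=
  heisenbergCriticalContinuity_iff.1 h

end Summit.CriticalPhenomena.PercolationContinuityZ3.Theorems.Transplant
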